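import Literature.Analysis.FluidPDE.FluidComputer.ThresholdLevelTableX
import HarnessLib

/-!
# Kernel run of the level-table checker over the WIDER gate-data box (all seven data within 1/300), chunks 4 … 7 (bp3 gen 13, layer 4: robustness variant X)

HONEST FRAMING: low prior, high value-of-information experiment on Tao's machine paradigm; NOT a
claim that NS blows up.

Four kernel evaluations (`decide +kernel`; no `native_decide`, no extra axioms) of `runSteps`
with the interval gate data `GIx` (all seven data within relative `1/300`, `δ ∈ [0, (1 + 1/300) δ₀]`),
25 steps each, from `Bx4` to `Bx8`.
-/

namespace Literature.Analysis.FluidPDE.FluidComputer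

namespace ThresholdLevelTable

set_option maxHeartbeats 10000000 in
set_option maxRecDepth 200000 in
/-- Chunk 4 of the wider-data-box table run (steps 100 … 124). [folklore] -/
theorem runX4 : runSteps 60 12 3 GIx RbIt Bx4 chunk4 1124126418046697 = some Bx5 := by
  decide +kernel

set_option maxHeartbeats 10000000 in
set_option maxRecDepth 200000 in
/-- Chunk 5 of the wider-data-box table run (steps 125 … 149). [folklore] -/
theorem runX5 : runSteps 60 12 3 GIx RbIt Bx5 chunk5 1337894513896634 = some Bx6 := by
  decide +kernel

set_option maxHeartbeats 10000000 in
set_option maxRecDepth 200000 in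
/-- Chunk 6 of the wider-data-box table run (steps 150 … 174). [folklore] -/
theorem runX6 : runSteps 60 12 3 GIx RbIt Bx6 chunk6 1592313552620694 = some Bx7 := by
  decide +kernel

set_option maxHeartbeats 10000000 in
set_option maxRecDepth 200000 in
/-- Chunk 7 of the wider-data-box table run (steps 175 … 199). [folklore] -/
theorem runX7 : runSteps 60 12 3 GIx RbIt Bx7 chunk7 1895113869982896 = some Bx8 := by
  decide +kernel

end ThresholdLevelTable

end Literature.Analysis.FluidPDE.FluidComputer
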